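import Mathlib
import Summits.Ventures.HodgeRepro.Tier4.Line4.OrbitDecay
import Summits.Ventures.HodgeRepro.Tier4.Line4.GASplit

/-!
# Tier4/Line4/ConvDecayL1 — C-L4-CONVDECAY-L1: the level-uniform decay of the convolution family `(finf ⊗ ffin N) ⋆ f₂ N`
through the `L¹` norm of the finite factor

Blind re-derivation cell `pub-hodge-repro`, Tier 4 «PROVE THE STEP», LINE L4, seat t4-x2 (g4, reserve wall-breaker),
crit-2 g7's S15066 (ii) / S15092 (d) («`hdecay` wants ONE `C` for the level family — with (R-25)(b)'s `L¹` clause on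
`ffin N` that is OrbitDecay (1) re-proved through the product-measure splitting»), TAKEN S15128.  Tree path
`lean/Summits/Ventures/HodgeRepro/Tier4/Line4/ConvDecayL1.lean`.  0 print, no `def`.

WHY.  L2-p3 g4's `norm_conv_le_exp_of_decay` (OrbitDecay p701703) bounds `‖((finf ⊗ ffin) ⋆ f₂)(x)‖` by
`C M₁ M₂ e^{3 c_K} μ(K⁻¹) e^{−3 archDist x}` with `‖ffin‖ ≤ M₁` a SUP bound; the natural level witness
`ffin N = vol(K(N))⁻¹ 1_{γ₀ K(N)}` has sup norm `vol(K(N))⁻¹ → ∞` and `L¹` norm `1` — so the level-UNIFORM decay of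
the family, the `hdecay` binder of FibreDominatedOfTail p703339, must go through the `L¹` clause `l1` of v0.34's
`TailFamily'` (L1ClassV4 p702851).  THE MATHEMATICS: `h ∈ x K⁻¹` or `f₂(h⁻¹ x) = 0`; on `x K⁻¹` the shift bound
`archDist x ≤ archDist h + c_K` (L2-p1's `archDist_mul_le`) gives `‖finf(h_∞)‖ ≤ C e^{3 c_K} e^{−3 archDist x}`; so
`‖(f₁ ⋆ f₂)(x)‖ ≤ C M₂ e^{3 c_K} e^{−3 archDist x} · ∫_{x K⁻¹} ‖ffin(h_f)‖ dμ(h)`, and the last integral, written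
through the product `G_∞ × G_f` (L4-p1's GASplit `integral_eq_smul_integral_prod_ga`, `μ = c · (μ_∞ × μ_f)`), is
`≤ c · μ_∞((x K⁻¹)_∞) · ‖ffin‖_{L¹(μ_f)} = c · μ_∞((K⁻¹)_∞) · ‖ffin‖_{L¹}` by the left invariance of `μ_∞` —
`N`-free once `‖ffin N‖_{L¹} ≤ M₁`.

* `infG_mul`, `infG_mul_fin`, `ofFinPart_inf_mul_fin` — the split of `a · b`, `a ∈ G_∞`, `b ∈ G_f`.
* `norm_conv_le_exp_of_decay_l1` — the bound above with every constant explicit.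
* `exists_norm_conv_le_exp_of_decay_l1_family` — the level family: `∃ C₀, ∀ N x, ‖((finf ⊗ ffin N) ⋆ f₂ N)(x)‖ ≤ C₀
  e^{−3 archDist x}` from `HasDecay3 W finf` and `TailFamily'`'s `l1` / `sup₂` / `supp₂` clauses verbatim.

Nothing here says anything about the status of the Hodge conjecture for CM abelian varieties, which is NOT proved
(HC_CM is NOT proved by anyone in this repository).
-/

set_option autoImplicit false

noncomputable section

namespace Summit.Ventures.HodgeRepro.Tier4.Line4.L1Class

open MeasureTheory Topology Filter NumberField Summit.Ventures.HodgeRepro.Tier4.Common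
  Summit.Ventures.HodgeRepro.Tier4.Line1 Summit.Ventures.HodgeRepro.Tier4.Line1.RTF

open scoped Pointwise NNReal

variable {k : Type} [Field k] [NumberField k] (W : PlaneData k)

/-! ## 1. The split of `a · b` for `a ∈ G_∞`, `b ∈ G_f` -/

/-- `infG` is multiplicative. -/
theorem infG_mul (g h : GA W) : infG W (g * h) = infG W g * infG W h := by
  apply Subtype.ext
  exact ofInfPart_mul W g h

/-- The archimedean component of `a · b` (`a ∈ G_∞`, `b ∈ G_f`) is `a`. -/
theorem infG_mul_fin (a : infinitePart W) (b : finitePart W) : infG W ((a : GA W) * (b : GA W)) = a := by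
  apply Subtype.ext
  change GA.ofInfPart W ((a : GA W) * (b : GA W)) = (a : GA W)
  rw [ofInfPart_mul, ofInfPart_eq_self_of_mem_infinitePart W a.2, ofInfPart_eq_one_of_mem_finitePart W b.2, mul_one]

/-- The finite component of `a · b` (`a ∈ G_∞`, `b ∈ G_f`) is `b`. -/
theorem ofFinPart_inf_mul_fin (a : infinitePart W) (b : finitePart W) :
    GA.ofFinPart W ((a : GA W) * (b : GA W)) = (b : GA W) := by
  rw [ofFinPart_mul, ofFinPart_eq_one_of_mem_infinitePart W a.2, ofFinPart_eq_self_of_mem_finitePart W b.2, one_mul]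

/-- `infG` is continuous. -/
theorem continuous_infG : Continuous (infG W) := (continuous_ofInfPart W).subtype_mk _

/-- The image under `infG` of a left translate is the left translate of the image. -/
theorem infG_image_smul (x : GA W) (s : Set (GA W)) : infG W '' (x • s) = infG W x • (infG W '' s) := by
  ext a
  constructor
  · rintro ⟨_, ⟨y, hy, rfl⟩, rfl⟩
    exact ⟨infG W y, ⟨y, hy, rfl⟩, (infG_mul W x y).symm⟩
  · rintro ⟨_, ⟨y, hy, rfl⟩, rfl⟩
    exact ⟨x * y, ⟨y, hy, rfl⟩, infG_mul W x y⟩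

/-! ## 2. The bound -/

section Bound

variable [MeasurableSpace (GA W)] [BorelSpace (GA W)]

/-- **C-L4-CONVDECAY-L1**: for `finf` of weight-3 decay, `ffin` a compactly supported finite factor of `L¹` norm `≤ M₁`
(for the Haar measure `μ_f` of `G_f`), `f₂` bounded by `M₂` with support in the compact `K`, and `μ = c · (μ_∞ × μ_f)`:
`‖((finf ⊗ ffin) ⋆ f₂)(x)‖ ≤ C M₁ M₂ e^{3 c_K} · c · μ_∞((K⁻¹)_∞) · e^{−3 archDist x}`. -/
theorem norm_conv_le_exp_of_decay_l1 (S : Setting (GA W)) (μinf : Measure (infinitePart W)) [μinf.IsHaarMeasure]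
    (μfin : Measure (finitePart W)) [μfin.IsHaarMeasure] {c : ℝ≥0}
    (hc : S.μ = c • Measure.map (gaSplit W).symm (μinf.prod μfin))
    {finf ffin f₂ : GA W → ℂ} {C : ℝ} (hC0 : 0 ≤ C) (hC : ∀ x, ‖finf x‖ ≤ C * Real.exp (-(3 * archDist W x)))
    (hffin : IsFinFactor W ffin) {M₁ : ℝ} (hl1 : ∫ x : finitePart W, ‖ffin (x : GA W)‖ ∂μfin ≤ M₁)
    {M₂ : ℝ} (hf₂ : ∀ x, ‖f₂ x‖ ≤ M₂) {K : Set (GA W)} (hK : IsCompact K) (hsupp : tsupport f₂ ⊆ K) {cK : ℝ}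
    (hcK : ∀ y ∈ K, archDist W y ≤ cK) (x : GA W) :
    ‖S.conv (prodFn W finf ffin) f₂ x‖ ≤
      C * M₁ * M₂ * Real.exp (3 * cK) * (c : ℝ) * μinf.real (infG W '' K⁻¹) *
        Real.exp (-(3 * archDist W x)) := by
  haveI := S.haar
  haveI := t2Space_GA W
  have hM₂ : 0 ≤ M₂ := (norm_nonneg _).trans (hf₂ 1)
  have hM₁ : 0 ≤ M₁ := (integral_nonneg fun _ => norm_nonneg _).trans hl1
  have hKinv : IsCompact K⁻¹ := hK.inv
  have hxK : IsCompact (x • K⁻¹) := hKinv.smul x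
  have hmeas : MeasurableSet (x • K⁻¹) := hxK.isClosed.measurableSet
  -- the continuous norm of the finite factor on `G(𝔸)`
  have hcont : Continuous fun h : GA W => ‖ffin (GA.ofFinPart W h)‖ :=
    (hffin.cont.comp (continuous_ofFinPart W)).norm
  set Φ : GA W → ℝ := (x • K⁻¹).indicator fun h => ‖ffin (GA.ofFinPart W h)‖ with hΦ
  have hΦnn : ∀ h, 0 ≤ Φ h := fun h => Set.indicator_nonneg (fun _ _ => norm_nonneg _) h
  have hΦint : Integrable Φ S.μ :=
    (integrable_indicator_iff hmeas).2 (hcont.continuousOn.integrableOn_compact hxK)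
  set D : ℝ := C * M₂ * Real.exp (3 * cK) * Real.exp (-(3 * archDist W x)) with hD
  have hD0 : 0 ≤ D := by
    rw [hD]
    positivity
  -- the pointwise bound of the integrand
  have hbound : ∀ h : GA W, ‖prodFn W finf ffin h * f₂ (h⁻¹ * x)‖ ≤ D * Φ h := by
    intro h
    by_cases hh : h ∈ x • K⁻¹
    · rw [hΦ, Set.indicator_of_mem hh]
      obtain ⟨y, hy, rfl⟩ := hh
      have hy' : y⁻¹ ∈ K := Set.inv_mem_inv.1 (by simpa using hy)
      have h1 : archDist W x ≤ archDist W (x • y) + cK := by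
        have e : x = (x • y) * y⁻¹ := by simp [smul_eq_mul]
        calc archDist W x = archDist W ((x • y) * y⁻¹) := by rw [← e]
          _ ≤ archDist W (x • y) + archDist W y⁻¹ := archDist_mul_le W _ _
          _ ≤ archDist W (x • y) + cK := by linarith [hcK y⁻¹ hy']
      have h2 : ‖finf (GA.ofInfPart W (x • y))‖ ≤ C * Real.exp (3 * cK) * Real.exp (-(3 * archDist W x)) := by
        calc ‖finf (GA.ofInfPart W (x • y))‖
            ≤ C * Real.exp (-(3 * archDist W (GA.ofInfPart W (x • y)))) := hC _
          _ = C * Real.exp (-(3 * archDist W (x • y))) := by rw [archDist_ofInfPart]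
          _ ≤ C * (Real.exp (3 * cK) * Real.exp (-(3 * archDist W x))) := by
              refine mul_le_mul_of_nonneg_left ?_ hC0
              rw [← Real.exp_add]
              exact Real.exp_le_exp.2 (by linarith)
          _ = C * Real.exp (3 * cK) * Real.exp (-(3 * archDist W x)) := by ring
      calc ‖prodFn W finf ffin (x • y) * f₂ ((x • y)⁻¹ * x)‖
          = ‖finf (GA.ofInfPart W (x • y))‖ * ‖ffin (GA.ofFinPart W (x • y))‖ * ‖f₂ ((x • y)⁻¹ * x)‖ := by
            simp only [prodFn, norm_mul]
        _ ≤ (C * Real.exp (3 * cK) * Real.exp (-(3 * archDist W x))) * ‖ffin (GA.ofFinPart W (x • y))‖ * M₂ := by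
            gcongr
            exact hf₂ _
        _ = D * ‖ffin (GA.ofFinPart W (x • y))‖ := by rw [hD]; ring
    · rw [hΦ, Set.indicator_of_notMem hh, mul_zero]
      have h0 : f₂ (h⁻¹ * x) = 0 := by
        by_contra hne
        apply hh
        have hmem : h⁻¹ * x ∈ K := hsupp (subset_tsupport _ hne)
        refine ⟨(h⁻¹ * x)⁻¹, Set.inv_mem_inv.2 hmem, ?_⟩
        simp [smul_eq_mul]
      simp [h0]
  -- the integral of `Φ` through the product `G_∞ × G_f`
  have hΦprod : ∫ h, Φ h ∂S.μ =
      (c : ℝ) * ∫ a : infinitePart W, ∫ b : finitePart W, Φ ((a : GA W) * (b : GA W)) ∂μfin ∂μinf := by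
    have h := integral_eq_smul_integral_prod_ga W S.μ μinf μfin c hc (fun h => (Φ h : ℂ)) hΦint.ofReal
    simp only [integral_complex_ofReal] at h
    rw [Complex.real_smul, ← Complex.ofReal_mul] at h
    exact_mod_cast h
  -- the inner integrals: `Φ(a b) ≤ 1_A(a) ‖ffin b‖` with `A = (x K⁻¹)_∞`
  set A : Set (infinitePart W) := infG W '' (x • K⁻¹) with hA
  have hAc : IsCompact A := hxK.image (continuous_infG W)
  have hAmeas : MeasurableSet A := hAc.isClosed.measurableSet
  have hffin_int : Integrable (fun b : finitePart W => ‖ffin (b : GA W)‖) μfin :=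
    (hffin.cont.comp continuous_subtype_val).norm.integrable_of_hasCompactSupport hffin.compact.norm
  have hinner : ∀ a : infinitePart W,
      ∫ b : finitePart W, Φ ((a : GA W) * (b : GA W)) ∂μfin ≤ A.indicator (fun _ => M₁) a := by
    intro a
    by_cases ha : a ∈ A
    · rw [Set.indicator_of_mem ha]
      refine le_trans (integral_mono_of_nonneg (Eventually.of_forall fun b => hΦnn _) hffin_int
        (Eventually.of_forall fun b => ?_)) hl1
      calc Φ ((a : GA W) * (b : GA W)) ≤ ‖ffin (GA.ofFinPart W ((a : GA W) * (b : GA W)))‖ :=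
            Set.indicator_le_self' (fun _ _ => norm_nonneg _) _
        _ = ‖ffin (b : GA W)‖ := by rw [ofFinPart_inf_mul_fin]
    · rw [Set.indicator_of_notMem ha]
      have hzero : ∀ b : finitePart W, Φ ((a : GA W) * (b : GA W)) = 0 := by
        intro b
        rw [hΦ, Set.indicator_of_notMem]
        intro hmem
        exact ha ⟨_, hmem, infG_mul_fin W a b⟩
      simp only [hzero, integral_zero, le_refl]
  have houter : ∫ a : infinitePart W, ∫ b : finitePart W, Φ ((a : GA W) * (b : GA W)) ∂μfin ∂μinf ≤
      M₁ * μinf.real (infG W '' K⁻¹) := by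
    have hAfin : μinf A ≠ ⊤ := hAc.measure_lt_top.ne
    calc ∫ a : infinitePart W, ∫ b : finitePart W, Φ ((a : GA W) * (b : GA W)) ∂μfin ∂μinf
        ≤ ∫ a : infinitePart W, A.indicator (fun _ => M₁) a ∂μinf :=
          integral_mono_of_nonneg (Eventually.of_forall fun a => integral_nonneg fun b => hΦnn _)
            ((integrable_indicator_iff hAmeas).2 (integrableOn_const hAfin)) (Eventually.of_forall hinner)
      _ = μinf.real A * M₁ := by rw [integral_indicator_const _ hAmeas, smul_eq_mul]
      _ = μinf.real (infG W '' K⁻¹) * M₁ := by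
          have hμA : μinf A = μinf (infG W '' K⁻¹) := by
            rw [hA, infG_image_smul, ← Set.image_smul]
            simp only [smul_eq_mul]
            rw [Set.image_mul_left, measure_preimage_mul]
          rw [measureReal_def, measureReal_def, hμA]
      _ = M₁ * μinf.real (infG W '' K⁻¹) := mul_comm _ _
  -- assemble
  calc ‖S.conv (prodFn W finf ffin) f₂ x‖
      = ‖∫ h, prodFn W finf ffin h * f₂ (h⁻¹ * x) ∂S.μ‖ := rfl
    _ ≤ ∫ h, D * Φ h ∂S.μ :=
        norm_integral_le_of_norm_le (hΦint.const_mul D) (Eventually.of_forall hbound)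
    _ = D * ∫ h, Φ h ∂S.μ := integral_const_mul D Φ
    _ = D * ((c : ℝ) * ∫ a : infinitePart W, ∫ b : finitePart W, Φ ((a : GA W) * (b : GA W)) ∂μfin ∂μinf) := by
        rw [hΦprod]
    _ ≤ D * ((c : ℝ) * (M₁ * μinf.real (infG W '' K⁻¹))) :=
        mul_le_mul_of_nonneg_left (mul_le_mul_of_nonneg_left houter (NNReal.coe_nonneg c)) hD0
    _ = C * M₁ * M₂ * Real.exp (3 * cK) * (c : ℝ) * μinf.real (infG W '' K⁻¹) *
        Real.exp (-(3 * archDist W x)) := by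
        rw [hD]
        ring

/-- **The level family**: from `HasDecay3 W finf` and the `l1` / `sup₂` / `supp₂` clauses of `TailFamily'` (v0.34 /
L1ClassV4, verbatim as binders) — ONE constant `C₀` with `‖((finf ⊗ ffin N) ⋆ f₂ N)(x)‖ ≤ C₀ e^{−3 archDist x}` for
every level `N` and every `x`.  The Haar pair of `G_∞ × G_f` is `Measure.haar` on each factor, `μ = c · (μ_∞ × μ_f)` by
Haar uniqueness (GASplit `exists_smul_map_prod_eq_ga`). -/
theorem exists_norm_conv_le_exp_of_decay_l1_family (S : Setting (GA W)) {finf : GA W → ℂ}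
    (hdec : HasDecay3 W finf) (ffin f₂ : ℕ → GA W → ℂ) (hfin : ∀ N, IsFinFactor W (ffin N))
    (hl1 : ∀ μf : Measure (finitePart W), μf.IsHaarMeasure →
      ∃ M₁ : ℝ, ∀ N, ∫ x : finitePart W, ‖ffin N (x : GA W)‖ ∂μf ≤ M₁)
    (hsup₂ : ∃ M₂ : ℝ, ∀ N x, ‖f₂ N x‖ ≤ M₂) (hsupp₂ : ∃ K : Set (GA W), IsCompact K ∧ ∀ N, tsupport (f₂ N) ⊆ K) :
    ∃ C₀ : ℝ, 0 ≤ C₀ ∧ ∀ N x, ‖S.conv (prodFn W finf (ffin N)) (f₂ N) x‖ ≤ C₀ * Real.exp (-(3 * archDist W x)) := by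
  haveI := S.haar
  haveI := t2Space_GA W
  haveI := locallyCompact_infinitePart W
  haveI := locallyCompact_finitePart W
  obtain ⟨C, hC0, hC⟩ := hdec.exists_nonneg W
  obtain ⟨M₂, hM₂⟩ := hsup₂
  obtain ⟨K, hK, hsupp⟩ := hsupp₂
  obtain ⟨cK, hcK⟩ := exists_archDist_le_of_isCompact W K hK
  obtain ⟨M₁, hM₁⟩ := hl1 (Measure.haar : Measure (finitePart W)) inferInstance
  obtain ⟨c, -, hc⟩ := exists_smul_map_prod_eq_ga W S.μ (Measure.haar : Measure (infinitePart W))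
    (Measure.haar : Measure (finitePart W))
  have hM₁0 : 0 ≤ M₁ := (integral_nonneg fun _ => norm_nonneg _).trans (hM₁ 0)
  have hM₂0 : 0 ≤ M₂ := (norm_nonneg _).trans (hM₂ 0 1)
  refine ⟨C * M₁ * M₂ * Real.exp (3 * max cK 0) * (c : ℝ) *
    (Measure.haar : Measure (infinitePart W)).real (infG W '' K⁻¹), by positivity, fun N x => ?_⟩
  exact norm_conv_le_exp_of_decay_l1 W S _ _ hc hC0 hC (hfin N) (hM₁ N) (hM₂ N) hK (hsupp N)
    (fun y hy => (hcK y hy).trans (le_max_left _ _)) x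

end Bound

end Summit.Ventures.HodgeRepro.Tier4.Line4.L1Class

end
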